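import Literature.LinearAlgebra.Matrix.LyapunovEquation

/-!
# Certified DECAY RATE from a Lyapunov margin: `−(AᴴG + GA) ⪰ m·1`, `O ≺ G ⪯ π·1` ⇒ `Re μ ≤ −m/(2π)`

Topic `LinearAlgebra/Matrix`; theorems only (no definition, no named fact, no instance). A sequel of
`LyapunovEquation.lean` (Carlson–Schneider 1962 § 1: the identity `x*(AᴴG + GA)x = 2 Re μ · x*Gx` at an
eigenvector `Ax = μx`, `star_dotProduct_lyapunov_mulVec_of_eigenvector`, and Lyapunov's theorem
`re_neg_of_neg_posDef_of_lyapunov_posDef`). The QUANTITATIVE reading a certificate prints: if the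
Lyapunov form has a margin, `m · x*x ≤ −x*(AᴴG + GA)x`, and the Lyapunov matrix is bounded,
`0 < x*Gx ≤ π · x*x` (`x ≠ 0`), then every eigenvalue `μ` of `A` satisfies `Re μ ≤ −m / (2π)` — the
same one-line computation at an eigenvector: `2 Re μ · x*Gx = x*(AᴴG + GA)x ≤ −m · x*x ≤ −(m/π) · x*Gx`.

* `re_le_neg_div_of_lyapunov_form_bounds` — complex matrices, hypotheses as Hermitian-form bounds;
* `re_le_neg_div_of_real_lyapunov_form_bounds` — the REAL form a validated-numerics certificate states:
  `J`, `P` real, `m · yᵀy ≤ yᵀQy` for `Q = −(JᵀP + PJ)`, `yᵀPy ≤ π · yᵀy`, `P ≻ O` (all as real quadratic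
  forms, e.g. from exact eigenvalue-margin certificates of `Q` and of `π·1 − P`) ⇒ every complex
  eigenvalue of `J` (spectrum of `J.map ofReal`) has `Re μ ≤ −m/(2π)`; in particular `J` is Hurwitz when
  `m > 0`. The real-to-complex step is the identity `Re(z*(S.map ofReal)z) = uᵀSu + vᵀSv` (`z = u + iv`).

HONEST FRAMING (cell certnum, seat certnum-sdp-4): this is the soundness statement behind the
«damping_rate_lower» field of the S3 (Lyapunov-polytopic) output of the margin call
`cap.spectral.param.min_eig_margin` (design note `run/shared/lean/pub/certnum/sdp/DESIGN-eigopt.md` §1 S3,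
§9 G3); it certifies no number — combined with `ParametricEigenMargin.mul_dotProduct_affine_ge_of_forall_vertex`
(the margin `m` of the affine family `Q(p)` on a box from its vertices) it gives the rate uniformly on the box.
NOT COVERED: anything when the margin certificate fails (a common quadratic `P` is sufficient only);
non-quadratic Lyapunov functions; time-varying or nonlinear systems beyond the matrix statement.

## References

* [CarlsonSchneider1962] D. Carlson, H. Schneider, *Inertia theorems for matrices: the semidefinite case*,
  J. Math. Anal. Appl. 6 (1963) 430–446, § 1 (the identity at an eigenvector; Lyapunov's theorem) — as cited
  in `LyapunovEquation.lean`; the rate form is its quantitative corollary.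
-/

open scoped ComplexOrder

namespace Literature.LinearAlgebra.Matrix

open _root_.Matrix

variable {n : Type*} [Fintype n] [DecidableEq n]

/-- An eigenvalue of a complex matrix has an eigenvector (plumbing; the same private lemma as in
`LyapunovEquation.lean`). [folklore] -/
private theorem exists_ne_zero_mulVec_eq_smul' {A : Matrix n n ℂ} {μ : ℂ} (hμ : μ ∈ spectrum ℂ A) :
    ∃ x : n → ℂ, x ≠ 0 ∧ A *ᵥ x = μ • x := by
  rw [← Matrix.spectrum_toLin', ← Module.End.hasEigenvalue_iff_mem_spectrum] at hμ
  obtain ⟨x, hx⟩ := hμ.exists_hasEigenvector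
  exact ⟨x, hx.2, by simpa [Matrix.toLin'_apply] using hx.apply_eq_smul⟩

omit [DecidableEq n] in
/-- `Re (x* x) > 0` for `x ≠ 0` (plumbing). [folklore] -/
private theorem re_star_dotProduct_self_pos {x : n → ℂ} (hx : x ≠ 0) : 0 < (star x ⬝ᵥ x).re := by
  have h : (star x ⬝ᵥ x).re = ∑ i, ‖x i‖ ^ 2 := by
    simp only [dotProduct, Pi.star_apply, Complex.re_sum]
    refine Finset.sum_congr rfl fun i _ ↦ ?_
    rw [Complex.star_def, ← Complex.normSq_eq_conj_mul_self, Complex.normSq_eq_norm_sq]; norm_cast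
  rw [h]
  obtain ⟨i, hi⟩ := Function.ne_iff.1 hx
  exact Finset.sum_pos' (fun j _ ↦ sq_nonneg _) ⟨i, Finset.mem_univ i, by positivity⟩

/-- **Decay rate from a Lyapunov margin (complex form).** If `0 ≤ m`, `0 < π`, the form of `G` is
positive and bounded, `0 < Re x*Gx ≤ π · Re x*x` for `x ≠ 0`, and the Lyapunov form has margin `m`,
`m · Re x*x ≤ −Re x*(AᴴG + GA)x`, then every eigenvalue `μ` of `A` has `Re μ ≤ −m/(2π)` (at an eigenvector:
`2 Re μ · x*Gx = x*(AᴴG + GA)x ≤ −m x*x ≤ −(m/π) x*Gx`).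
[cite: CarlsonSchneider1962, § 1 (identity at an eigenvector; Lyapunov's theorem), quantitative corollary] -/
theorem re_le_neg_div_of_lyapunov_form_bounds {A G : Matrix n n ℂ} {m π : ℝ} (hm : 0 ≤ m) (hπ : 0 < π)
    (hGpos : ∀ x : n → ℂ, x ≠ 0 → 0 < (star x ⬝ᵥ (G *ᵥ x)).re)
    (hGπ : ∀ x : n → ℂ, (star x ⬝ᵥ (G *ᵥ x)).re ≤ π * (star x ⬝ᵥ x).re)
    (hQ : ∀ x : n → ℂ, m * (star x ⬝ᵥ x).re ≤ -(star x ⬝ᵥ ((Aᴴ * G + G * A) *ᵥ x)).re)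
    {μ : ℂ} (hμ : μ ∈ spectrum ℂ A) : μ.re ≤ -m / (2 * π) := by
  obtain ⟨x, hx0, hx⟩ := exists_ne_zero_mulVec_eq_smul' hμ
  have hid := star_dotProduct_lyapunov_mulVec_of_eigenvector G hx
  -- real part of the identity: Re x*(AᴴG+GA)x = 2 Re μ · Re x*Gx
  have hre : (star x ⬝ᵥ ((Aᴴ * G + G * A) *ᵥ x)).re = 2 * μ.re * (star x ⬝ᵥ (G *ᵥ x)).re := by
    have e : starRingEnd ℂ μ + μ = ((2 * μ.re : ℝ) : ℂ) := by
      apply Complex.ext <;> simp [two_mul]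
    rw [hid, e, Complex.re_ofReal_mul]
  set g := (star x ⬝ᵥ (G *ᵥ x)).re with hg
  set s := (star x ⬝ᵥ x).re with hs
  have hg0 : 0 < g := hGpos x hx0
  have hs0 : 0 < s := re_star_dotProduct_self_pos hx0
  have h1 : 2 * μ.re * g ≤ -(m * s) := by
    have := hQ x; rw [hre] at this; linarith
  have hgs : g ≤ π * s := hGπ x
  -- conclude: 2π Re μ ≤ −m
  have h2 : 2 * π * μ.re ≤ -m := by
    by_cases hμ0 : 0 ≤ μ.re
    · -- then m·s ≤ 0 forces m = 0 and Re μ ≤ 0, hence Re μ = 0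
      have h3 : 2 * μ.re * g ≤ 0 := h1.trans (by nlinarith)
      have h4 : μ.re ≤ 0 := by nlinarith
      have h5 : μ.re = 0 := le_antisymm h4 hμ0
      have h6 : m * s ≤ 0 := by nlinarith
      have h7 : m = 0 := le_antisymm (by nlinarith) hm
      rw [h5, h7]; simp
    · have hμ0 : μ.re < 0 := not_le.mp hμ0
      -- Re μ < 0: 2 Re μ · π s ≤ 2 Re μ · g ≤ −m s
      have h3 : 2 * μ.re * (π * s) ≤ 2 * μ.re * g := by nlinarith
      nlinarith
  rw [le_div_iff₀ (by positivity)]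
  linarith

/-! ### Real data: the form the certificate states -/

omit [DecidableEq n] in
/-- `Re (z* (S.map ofReal) z) = uᵀSu + vᵀSv` for a real matrix `S` and `z = u + iv` (term by term; no
symmetry needed). [folklore] -/
private theorem re_star_dotProduct_map_ofReal_mulVec (S : Matrix n n ℝ) (z : n → ℂ) :
    (star z ⬝ᵥ ((S.map (algebraMap ℝ ℂ)) *ᵥ z)).re
      = (fun i ↦ (z i).re) ⬝ᵥ (S *ᵥ fun i ↦ (z i).re) + (fun i ↦ (z i).im) ⬝ᵥ (S *ᵥ fun i ↦ (z i).im) := by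
  simp only [dotProduct, Matrix.mulVec, Matrix.map_apply, Complex.re_sum, Finset.mul_sum,
    ← Finset.sum_add_distrib]
  refine Finset.sum_congr rfl fun i _ ↦ Finset.sum_congr rfl fun j _ ↦ ?_
  simp only [Pi.star_apply, Complex.star_def, Complex.mul_re, Complex.conj_re, Complex.conj_im,
    Complex.coe_algebraMap, Complex.ofReal_re, Complex.ofReal_im, zero_mul, sub_zero, Complex.mul_im, add_zero]
  ring

omit [DecidableEq n] in
/-- `Re (z* z) = uᵀu + vᵀv` for `z = u + iv`. [folklore] -/
private theorem re_star_dotProduct_self_eq (z : n → ℂ) :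
    (star z ⬝ᵥ z).re = (fun i ↦ (z i).re) ⬝ᵥ (fun i ↦ (z i).re) + (fun i ↦ (z i).im) ⬝ᵥ (fun i ↦ (z i).im) := by
  simp only [dotProduct, Pi.star_apply, Complex.re_sum, ← Finset.sum_add_distrib]
  refine Finset.sum_congr rfl fun i _ ↦ ?_
  simp only [Complex.star_def, Complex.mul_re, Complex.conj_re, Complex.conj_im]
  ring

omit [DecidableEq n] in
/-- `(J.map ofReal)ᴴ * (P.map ofReal) + (P.map ofReal) * (J.map ofReal) = (Jᵀ * P + P * J).map ofReal` for
real `J`, `P`. [folklore] -/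
private theorem lyapunov_map_ofReal (J P : Matrix n n ℝ) :
    (J.map (algebraMap ℝ ℂ))ᴴ * P.map (algebraMap ℝ ℂ) + P.map (algebraMap ℝ ℂ) * J.map (algebraMap ℝ ℂ)
      = (Jᵀ * P + P * J).map (algebraMap ℝ ℂ) := by
  have hct : (J.map (algebraMap ℝ ℂ))ᴴ = Jᵀ.map (algebraMap ℝ ℂ) := by
    ext i j
    simp [Matrix.conjTranspose_apply, Matrix.map_apply, Matrix.transpose_apply, Complex.coe_algebraMap]
  rw [hct, Matrix.map_add (algebraMap ℝ ℂ) (map_add _), Matrix.map_mul, Matrix.map_mul]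

/-- **Certified decay rate of a real matrix from Lyapunov form margins** (the statement an S3 certificate
prints). Let `J`, `P` be real `n × n` matrices, `0 ≤ m`, `0 < π`, with `P ≻ O`, `yᵀPy ≤ π · yᵀy` for all real
`y`, and `m · yᵀy ≤ −yᵀ(JᵀP + PJ)y` for all real `y`. Then every complex eigenvalue `μ` of `J` satisfies
`Re μ ≤ −m/(2π)`; in particular `J` is Hurwitz when `m > 0`.
[cite: CarlsonSchneider1962, § 1 (identity at an eigenvector; Lyapunov's theorem), quantitative corollary, real data] -/
theorem re_le_neg_div_of_real_lyapunov_form_bounds {J P : Matrix n n ℝ} {m π : ℝ} (hm : 0 ≤ m)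
    (hπ : 0 < π) (hP : P.PosDef) (hPπ : ∀ y : n → ℝ, y ⬝ᵥ (P *ᵥ y) ≤ π * (y ⬝ᵥ y))
    (hQ : ∀ y : n → ℝ, m * (y ⬝ᵥ y) ≤ -(y ⬝ᵥ ((Jᵀ * P + P * J) *ᵥ y)))
    {μ : ℂ} (hμ : μ ∈ spectrum ℂ (J.map (algebraMap ℝ ℂ))) : μ.re ≤ -m / (2 * π) := by
  refine re_le_neg_div_of_lyapunov_form_bounds (G := P.map (algebraMap ℝ ℂ)) hm hπ ?_ ?_ ?_ hμ
  · intro x hx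
    rw [re_star_dotProduct_map_ofReal_mulVec]
    have hPs := hP.posSemidef
    have h0 : ∀ y : n → ℝ, 0 ≤ y ⬝ᵥ (P *ᵥ y) := fun y ↦ by
      simpa using hPs.dotProduct_mulVec_nonneg y
    -- one of the real / imaginary parts is non-zero
    by_cases hre : (fun i ↦ (x i).re) = 0
    · have him : (fun i ↦ (x i).im) ≠ 0 := by
        intro him; apply hx; funext i
        exact Complex.ext (congrFun hre i) (congrFun him i)
      have := hP.dotProduct_mulVec_pos him
      rw [star_trivial] at this
      linarith [h0 (fun i ↦ (x i).re)]
    · have := hP.dotProduct_mulVec_pos hre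
      rw [star_trivial] at this
      linarith [h0 (fun i ↦ (x i).im)]
  · intro x
    rw [re_star_dotProduct_map_ofReal_mulVec, re_star_dotProduct_self_eq, mul_add]
    exact add_le_add (hPπ _) (hPπ _)
  · intro x
    rw [lyapunov_map_ofReal, re_star_dotProduct_map_ofReal_mulVec, re_star_dotProduct_self_eq, mul_add,
      neg_add]
    exact add_le_add (hQ _) (hQ _)

/-- **Hurwitz from a positive Lyapunov margin (real data)**: under the hypotheses of
`re_le_neg_div_of_real_lyapunov_form_bounds` with `m > 0`, every eigenvalue of `J` has negative real part.
[cite: CarlsonSchneider1962, § 1 (Lyapunov's theorem), real data with margins] -/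
theorem re_neg_of_real_lyapunov_form_bounds {J P : Matrix n n ℝ} {m π : ℝ} (hm : 0 < m) (hπ : 0 < π)
    (hP : P.PosDef) (hPπ : ∀ y : n → ℝ, y ⬝ᵥ (P *ᵥ y) ≤ π * (y ⬝ᵥ y))
    (hQ : ∀ y : n → ℝ, m * (y ⬝ᵥ y) ≤ -(y ⬝ᵥ ((Jᵀ * P + P * J) *ᵥ y)))
    {μ : ℂ} (hμ : μ ∈ spectrum ℂ (J.map (algebraMap ℝ ℂ))) : μ.re < 0 :=
  (re_le_neg_div_of_real_lyapunov_form_bounds hm.le hπ hP hPπ hQ hμ).trans_lt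
    (by rw [neg_div]; exact neg_neg_of_pos (by positivity))

end Literature.LinearAlgebra.Matrix
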